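import Summits.AnomalousDissipation.AnomalousDissipation.Theorems.SolenoidalFractalHomogenisationLagrangianStepFrameDefs
import HarnessLib

/-!
# K1L_D (stmt-AnomalousDissipation-27980), stub S23″: the frame map preserves integrals, `L²` norms and pairings (S3′ brick D2 / S1′(c) / W3)
# (helper; `--supports … --as helper`)

The window flow maps `E.X m t s` of a regular Lagrangian carrier preserve the volume of the torus (`LevelRegular` (F2c)).  Consequences used all
over the window ledger: composition with `E.X m t s` preserves Bochner integrals of a.e.-strongly measurable integrands, extended integrals, `MemLp`,
the `L²` energy of a frame field (`conjField`, `…FrameDefs` p647381) and `L²` pairings — the identity `⟪y, u⟫_phys = ⟪y∘X, u∘X⟫` that moves the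
ledger's pairing `⟪y, e_j⟫` into the frame where the cell-side bounds (V_G)/(X_G) are stated.  Infrastructure for rung F-D1.A0; NOT a proof of the
crux or of anomalous dissipation.
-/

set_option linter.dupNamespace false

namespace Summit.AnomalousDissipation.AnomalousDissipation.Theorems.SolenoidalFractalHomogenisation.LagrangianStep

open MeasureTheory Literature.Analysis Literature.Analysis.FluidPDE Literature.Analysis.FluidPDE.LatticeShear
open scoped ENNReal InnerProductSpace

variable {k : ℕ}

/-- **Change of variables under a window flow map (Bochner)**: `∫ g (X x) dx = ∫ g` for a.e.-strongly measurable `g`. -/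
theorem integral_comp_X {G : Type*} [NormedAddCommGroup G] [NormedSpace ℝ G] (E : LagrangianLatticeCarrier k) (hR : E.LevelRegular)
    (m : ℕ) (t s : ℝ) {g : UnitAddTorus (Fin 3) → G} (hg : AEStronglyMeasurable g volume) :
    ∫ x, g (E.X m t s x) = ∫ x, g x := by
  have h := hR.measurePreserving_X m t s
  have hg' : AEStronglyMeasurable g (Measure.map (E.X m t s) volume) := by rw [h.map_eq]; exact hg
  rw [← integral_map h.measurable.aemeasurable hg', h.map_eq]

/-- **Change of variables under a window flow map (extended)**: `∫⁻ f (X x) dx = ∫⁻ f` for a.e.-measurable `f`. -/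
theorem lintegral_comp_X (E : LagrangianLatticeCarrier k) (hR : E.LevelRegular) (m : ℕ) (t s : ℝ)
    {f : UnitAddTorus (Fin 3) → ℝ≥0∞} (hf : AEMeasurable f volume) :
    ∫⁻ x, f (E.X m t s x) = ∫⁻ x, f x := by
  have h := hR.measurePreserving_X m t s
  have hf' : AEMeasurable f (Measure.map (E.X m t s) volume) := by rw [h.map_eq]; exact hf
  rw [← lintegral_map' hf' h.measurable.aemeasurable, h.map_eq]

/-- Composition with a window flow map preserves `MemLp`. -/
theorem memLp_comp_X {G : Type*} [NormedAddCommGroup G] (E : LagrangianLatticeCarrier k) (hR : E.LevelRegular) (m : ℕ) (t s : ℝ)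
    {p : ℝ≥0∞} {g : UnitAddTorus (Fin 3) → G} (hg : MemLp g p volume) : MemLp (g ∘ E.X m t s) p volume :=
  hg.comp_measurePreserving (hR.measurePreserving_X m t s)

/-- **The frame field has the same `L²` energy**: `∫ ‖conjField E m w u s‖² = ∫ ‖u s‖²`. -/
theorem integral_norm_sq_conjField (E : LagrangianLatticeCarrier k) (hR : E.LevelRegular) (m : ℕ) (w : ℝ) (u : ℝ → VF) (s : ℝ)
    (hu : AEStronglyMeasurable (u s) volume) :
    ∫ x, ‖conjField E m w u s x‖ ^ 2 = ∫ x, ‖u s x‖ ^ 2 := by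
  unfold conjField
  exact integral_comp_X E hR m (w + s) w (g := fun x => ‖u s x‖ ^ 2) (hu.norm.pow 2)

/-- **Pairings move to the frame**: `∫ ⟪y (X x), v (X x)⟫ dx = ∫ ⟪y, v⟫` for a.e.-strongly measurable fields. -/
theorem integral_inner_comp_X (E : LagrangianLatticeCarrier k) (hR : E.LevelRegular) (m : ℕ) (t s : ℝ) {y v : VF}
    (hy : AEStronglyMeasurable y volume) (hv : AEStronglyMeasurable v volume) :
    ∫ x, ⟪y (E.X m t s x), v (E.X m t s x)⟫_ℝ = ∫ x, ⟪y x, v x⟫_ℝ :=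
  integral_comp_X E hR m t s (g := fun x => ⟪y x, v x⟫_ℝ) (hy.inner hv)

-- (the mutual inverse property `E.X m t s (E.X m s t x) = x` is `…LagrangianRenormalisationStep.X_X_symm` in `…TailLevels` — reuse it.)

end Summit.AnomalousDissipation.AnomalousDissipation.Theorems.SolenoidalFractalHomogenisation.LagrangianStep
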